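import Mathlib
import HarnessLib
import Summits.NavierStokesRegularity.NavierStokesRegularity.Theses.AdaptedFrequency
import Literature.Analysis.FluidPDE.AdaptedBackwardKernel
import Literature.Analysis.FluidPDE.SelfSimilar
import Literature.Analysis.FluidPDE.PineauVicolRSS

/-!
# Line `moving-adjoint-bernoulli` — crux `AdaptedFrequency.FrequencyRigidity` (stmt-NavierStokesRegularity-2955)

Registered skeleton of the proving line built from the crux idea card
`Cruxes/FrequencyRigidity/Ideas/moving-adjoint-bernoulli.md` (ideator 2, round 1; triage r1-1/2/3: pass ×3,
"merge with kernel-paired-head-pressure; fold rotation-gauged-head's §RSS in"), planner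
`planner-cruxplan-stmt-NavierStokesRegularity-2955-moving-adjoint-berno-0`, 2026-08-16.  Line card:
`Cruxes/FrequencyRigidity/Lines/moving-adjoint-bernoulli.md`.

## Shape (six registered stubs `stub_*`, composition `FrequencyRigidity_of` sorry-free)

The crux is `¬ ∃ (ν C Λ₀ v q K), …`: no smooth ancient Navier–Stokes flow on `ℝ³ × (−∞,0)` with the GLOBAL
Type-I bound `‖v(t,x)‖ ≤ C/√(−t)`, an adapted Gaussian-comparable kernel `K` at `(0,0)`, positive adapted
enstrophy `H = ∫‖curl v‖²K` and CONSTANT adapted frequency `Λ ≡ Λ₀`.  A witness is carried through: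

* `stub_normalForm` (S1, provable, L) — KNSS NORMAL FORM of a witness: kill the Galilei wobble (the centred
  comparable kernel pins it), pass to the mild representative with the kernel-mean-zero pressure gauge
  `∫ π(t) K(t) = 0`, record the scale-invariant smoothing bounds (`(−t)‖curl w‖ ≤ M`, `√(−t)‖w‖`,
  `(−t)‖∇w‖`, `(−t)^{3/2}(‖∇²w‖ + ‖∂ₜw‖)`, `(−t)|π|`, `(−t)^{3/2}‖∇π‖`, `(−t)²|∂ₜπ|` polynomially bounded in
  `|x|/√(−t)`) and the kernel first variation (`H` differentiable).  [G6 / finding 1 of the triage.]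
* PINNING (not a stub — CHECKED: the Disproof's theorems (T) `FreqClause.exponent_eq_two` +
  `FreqClause.power_law`, re-proved VERBATIM in §Pinning below so that this file does not depend on the
  disprover's evolving workfile) give `Λ₀ = 2` and `H(t) = A(−t)⁻²` EXACTLY, `A = H(−1) > 0`, from S1's vorticity
  bound, unit mass of `K` and differentiability of `H` (the composition proves the enstrophy bound
  `H ≤ M²(−t)⁻²` itself).
* `stub_movingAdjointBernoulli` (S2, provable, M–L) — THE LEVER: the crux's own kernel is an exact moving
  adjoint weight for the unsteady Bernoulli/head operator, `d/dt ∫(½|w|²+π)K = −ν H(t) + ∫(∂ₜπ)K`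
  (transport drops out identically by the adjoint clause; `Δπ = |ω|² − |∇w|²`).
* `stub_rotatingWaveReduction` (S4, OPEN — the line's bet, hardest): a normal-form witness with flat
  enstrophy obeying the head law has a SCALING LIMIT (rescalings `μₙ w(μₙ²t, μₙx)`, any positive scales)
  which is a ROTATING WAVE `v∞ = pvAnsatz α U₀` (rotated self-similar about the pole; `α = 0` = Leray
  self-similar).  Route inside: secular pressure-work law (integrate S2 in log-time: the Cesàro mean of the
  kernel-paired pressure tendency is `νA > 0` at BOTH ends) ⇒ uniformly unsteady kernel ⇒ (Type-I compactness,
  minimal element of the translation hull) ⇒ the only kernel motion compatible with flat `H` at every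
  instant is rigid rotation.
* `stub_scalingClosure` (S3, provable, L) — Type-I compactness bookkeeping: scaling limits of normal-form
  flat witnesses are witnesses (same `ν`, same Type-I constant, comparable kernel with the same constants,
  `H∞ = A(−t)⁻²`, `Λ∞ ≡ 2`).
* `stub_selfSimilarLeaf` (S5, provable, M) — an exactly self-similar witness (`α = 0`) is impossible: its
  slice is a bounded Leray profile, constant by Tsai 1998 Thm 1 `q = ∞` (tree theorem
  `tsai_selfsimilar_bounded_holds`; or in one line by pairing Tsai's identity with the steady kernel), so
  `curl ≡ 0`, contradicting `H > 0`.
* `stub_rotatedLeaf` (S6, OPEN wall shared by every line on this crux) — a rotated self-similar witness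
  (`α ≠ 0`, BOUNDED profile) is impossible: Pineau–Vicol 2026 Conj. 1.1 in the bounded-profile class
  (their Thm 1.4 = `pineauVicol2026_rss_liouville` covers `|α| ≪ 1`, `|α| ≫ 1` for DECAYING profiles);
  the line's torque form `ν𝓗₀ = −α⟨∂_θP⟩_𝔎`, `𝓗₀ ≤ 4α²ν`-type bounds (rotation-gauged-head,
  `Ideator1TorqueProof.lean`) are the intended entry.

Composition (`composition`, `FrequencyRigidity_of`): witness ⇒ S1 normal form ⇒ (T) `Λ₀ = 2`, flat `H` ⇒
S2 head law ⇒ S4 rotating-wave scaling limit ⇒ S3 it is a witness ⇒ S5 (`α = 0`) / S6 (`α ≠ 0`) ⇒ `False`.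

Stub signatures are written over tree declarations only (`IsClassicalNSSolutionOn`, `HasTypeITimeDecay`,
`IsAdaptedBackwardKernel`, `IsGaussianComparable`, `adaptedEnstrophy`, `adaptedFrequency`, `curl`,
`timeDerivWithin`, `pvAnsatz`, Mathlib), fully qualified, so that a Theorems file can restate and prove
each stub by name + signature without importing this module; the `def`s `IsWitness`, `ScaleInvariantBounds`,
`IsNormalForm`, `HasFlatEnstrophy`, `HeadLaw`, `IsScalingLimit`, `IsRotatingWave` below are definitionally
equal readable aliases used by the composition theorems.

Disproof used (`Cruxes/FrequencyRigidity/Disproof.lean`, cdisprove v3 @ b1b50a35c3b0, NO KILL; read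
2026-08-16): (T) `FreqClause.power_law` / `FreqClause.exponent_eq_two` (+ the two power-law
comparison lemmas) are COPIED VERBATIM into §Pinning (namespace `…MovingAdjointBernoulli.Pinning`, same
names and statements; attribution there) and USED in `pinning_of_normalForm` — pinning is neither a stub
nor new work of this line (the copy, rather than an `import`, only decouples this skeleton from later edits
of the disprover's workfile: the farm reported the module incoherent while this line was being published); (A) `frequencyRigidity_false_without_posH` honoured — `H > 0` enters at
pinning (`A = H(−1) > 0`) and is what the leaves S5/S6 contradict (`curl U₀ ≡ 0 ⇒ H = 0`); (B)
`frequencyRigidity_false_without_typeI` / `_false_with_local_typeI` honoured — the GLOBAL bound is used at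
S1 (scale-invariant smoothing bounds on all of `ℝ³ × (−∞,0)`, hence `H ≤ M²(−t)⁻²` at BOTH ends, which is
what pins `Λ₀ = 2`; the rigid-rotation witness of (B) has `Λ₀ = 0`), at S3 (compactness with the same
constant) and at S5/S6 (bounded profile); (C) `frequencyRigidity_false_without_momentum` honoured — S2 IS the
momentum equation dotted with `w` against `K` (the kinematic self-similar swirl of (C), `Λ ≡ 2`, violates the
head law), and S5/S6 are NS Liouville theorems (the swirl of (C) is exactly an `α = 0` rotating wave that only
the dynamics excludes).  No `-- Targets` stub kill and no landed `Theorems/FrequencyRigidity/Negative/` lemma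
exists (`ledger crux ls`, 2026-08-16).  Negatives index (`ledger negatives`): stmt-4055 (Galilei-gauge
parasitic modes) is honoured by S1's gauge fixing — every pressure-level statement below is in the mild,
kernel-mean-zero gauge; stmt-0154 unrelated.
-/

set_option linter.dupNamespace false

noncomputable section

namespace Summit.NavierStokesRegularity.NavierStokesRegularity.Cruxes.FrequencyRigidity.MovingAdjointBernoulli

open MeasureTheory Set Filter Topology Function
open Literature.Analysis.FluidPDE

local notation "ℝ³" => EuclideanSpace ℝ (Fin 3)

/-! ## Readable aliases (definitionally the bundles appearing in the stub signatures) -/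

/-- A WITNESS against the crux: the `∃`-body of `FrequencyRigidity` with the five kernel clauses and the
Gaussian comparability folded into the tree's `IsAdaptedBackwardKernel` / `IsGaussianComparable`
(pole `(0,0)`, time set `Iio 0`) and `H`, `Λ` folded into `adaptedEnstrophy`, `adaptedFrequency … 0`
(all four unfold verbatim to the crux's inline clauses: `isAdaptedBackwardKernel_iff`,
`isGaussianComparable_iff_fin_three`, `adaptedEnstrophy_apply`, `adaptedFrequency_apply`). -/
def IsWitness (ν C Λ₀ : ℝ) (v : ℝ → ℝ³ → ℝ³) (q : ℝ → ℝ³ → ℝ) (K : ℝ → ℝ³ → ℝ) : Prop :=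
  0 < ν ∧ IsClassicalNSSolutionOn (Iio 0) ν 0 v q ∧ HasTypeITimeDecay C v ∧
    IsAdaptedBackwardKernel ν v (Iio 0) 0 0 K ∧ IsGaussianComparable K (Iio 0) 0 0 ∧
    (∀ t < 0, 0 < adaptedEnstrophy v K t) ∧ (∀ t < 0, adaptedFrequency v K 0 t = Λ₀)

/-- SCALE-INVARIANT SMOOTHING BOUNDS of a normal-form witness (KNSS-type, constant `M`, polynomial degree
`N` in the similarity variable `|x|/√(−t)`): the vorticity bound `(−t)‖curl w‖ ≤ M` that pins `Λ₀ = 2`,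
and the growth bounds on `w, ∇w, ∇²w, ∂ₜw, π, ∇π, ∂ₜπ` that legitimise the kernel pairings of S2 and the
compactness of S3/S4. -/
def ScaleInvariantBounds (M : ℝ) (N : ℕ) (w : ℝ → ℝ³ → ℝ³) (π : ℝ → ℝ³ → ℝ) : Prop :=
  ∀ t < 0, ∀ x,
    ‖curl (w t) x‖ ≤ M / (-t) ∧
    Real.sqrt (-t) * ‖w t x‖ + (-t) * ‖fderiv ℝ (w t) x‖ +
        (-t) * Real.sqrt (-t) * (‖iteratedFDeriv ℝ 2 (w t) x‖ + ‖timeDerivWithin (Iio 0) w t x‖) +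
        (-t) * |π t x| + (-t) * Real.sqrt (-t) * ‖fderiv ℝ (π t) x‖ +
        (-t) ^ 2 * |timeDerivWithin (Iio 0) π t x|
      ≤ M * (1 + ‖x‖ / Real.sqrt (-t)) ^ N

/-- NORMAL FORM of a witness: a witness `(w, π, K)` (mild representative, no Galilei wobble) with the
scale-invariant bounds, the kernel-mean-zero pressure gauge `∫ π(t) K(t) = 0`, and differentiable adapted
enstrophy (kernel first variation). -/
def IsNormalForm (ν C Λ₀ M : ℝ) (N : ℕ) (w : ℝ → ℝ³ → ℝ³) (π : ℝ → ℝ³ → ℝ) (K : ℝ → ℝ³ → ℝ) : Prop :=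
  IsWitness ν C Λ₀ w π K ∧ ScaleInvariantBounds M N w π ∧
    (∀ t < 0, ∫ x, π t x * K t x = 0) ∧ (∀ t < 0, DifferentiableAt ℝ (adaptedEnstrophy w K) t)

/-- FLAT adapted enstrophy: `H(t) = A(−t)⁻²` exactly, `A > 0` (the pinned form (T) forces on a witness). -/
def HasFlatEnstrophy (A : ℝ) (w : ℝ → ℝ³ → ℝ³) (K : ℝ → ℝ³ → ℝ) : Prop :=
  0 < A ∧ ∀ t < 0, adaptedEnstrophy w K t = A * (-t) ^ (-(2:ℝ))

/-- THE HEAD LAW (moving-adjoint Bernoulli identity): `d/dt ∫(½|w|² + π)K = −ν H(t) + ∫(∂ₜπ)K` on `(−∞,0)`. -/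
def HeadLaw (ν : ℝ) (w : ℝ → ℝ³ → ℝ³) (π : ℝ → ℝ³ → ℝ) (K : ℝ → ℝ³ → ℝ) : Prop :=
  ∀ t < 0, HasDerivAt (fun τ => ∫ x, (2⁻¹ * ‖w τ x‖ ^ 2 + π τ x) * K τ x)
    (-ν * adaptedEnstrophy w K t + ∫ x, timeDerivWithin (Iio 0) π t x * K t x) t

/-- SCALING LIMIT: along positive scales `μₙ` the Navier–Stokes rescalings of `(w, π, K)` about the pole
(`μ w(μ²t, μx)`, `μ² π(μ²t, μx)`, `μ³ K(μ²t, μx)` — each again a witness with the same constants) converge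
slice-wise locally uniformly to `(v∞, q∞, K∞)`.  Nothing is assumed about `lim μₙ` (`→ ∞`: far past;
`→ 0`: the singular time; constant: the witness itself). -/
def IsScalingLimit (μ : ℕ → ℝ) (w : ℝ → ℝ³ → ℝ³) (π : ℝ → ℝ³ → ℝ) (K : ℝ → ℝ³ → ℝ)
    (v : ℝ → ℝ³ → ℝ³) (q : ℝ → ℝ³ → ℝ) (G : ℝ → ℝ³ → ℝ) : Prop :=
  (∀ n, 0 < μ n) ∧
    (∀ t < 0, TendstoLocallyUniformly (fun (n : ℕ) (x : ℝ³) => μ n • w (μ n ^ 2 * t) (μ n • x)) (v t) atTop) ∧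
    (∀ t < 0, TendstoLocallyUniformly (fun (n : ℕ) (x : ℝ³) => μ n ^ 2 * π (μ n ^ 2 * t) (μ n • x)) (q t) atTop) ∧
    (∀ t < 0, TendstoLocallyUniformly (fun (n : ℕ) (x : ℝ³) => μ n ^ 3 * K (μ n ^ 2 * t) (μ n • x)) (G t) atTop)

/-- ROTATING WAVE about the pole with angular speed `α` and profile `U₀` (Pineau–Vicol's backward rotated
self-similar ansatz (1.7), tree `pvAnsatz`; `α = 0` is Leray's self-similar ansatz). -/
def IsRotatingWave (α : ℝ) (U₀ : ℝ³ → ℝ³) (v : ℝ → ℝ³ → ℝ³) : Prop :=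
  ∀ t < 0, ∀ x, v t x = pvAnsatz α (fun y _ => U₀ y) t x

/-! ## The six statements (readable form) -/

/-- S1 — NORMAL FORM EXISTS (provable, L). -/
def NormalFormExists : Prop :=
  ∀ (ν C Λ₀ : ℝ) (v : ℝ → ℝ³ → ℝ³) (q : ℝ → ℝ³ → ℝ) (K : ℝ → ℝ³ → ℝ), IsWitness ν C Λ₀ v q K →
    ∃ (C' M : ℝ) (N : ℕ) (w : ℝ → ℝ³ → ℝ³) (π : ℝ → ℝ³ → ℝ) (K' : ℝ → ℝ³ → ℝ),
      IsNormalForm ν C' Λ₀ M N w π K'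

/-- S2 — MOVING-ADJOINT BERNOULLI IDENTITY (provable, M–L). -/
def MovingAdjointBernoulli : Prop :=
  ∀ (ν M : ℝ) (N : ℕ) (w : ℝ → ℝ³ → ℝ³) (π : ℝ → ℝ³ → ℝ) (K : ℝ → ℝ³ → ℝ), 0 < ν →
    IsClassicalNSSolutionOn (Iio 0) ν 0 w π → IsAdaptedBackwardKernel ν w (Iio 0) 0 0 K →
    IsGaussianComparable K (Iio 0) 0 0 → ScaleInvariantBounds M N w π → HeadLaw ν w π K

/-- S3 — SCALING CLOSURE (provable, L). -/
def ScalingClosure : Prop :=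
  ∀ (ν C M A : ℝ) (N : ℕ) (μ : ℕ → ℝ) (w : ℝ → ℝ³ → ℝ³) (π : ℝ → ℝ³ → ℝ) (K : ℝ → ℝ³ → ℝ)
    (v : ℝ → ℝ³ → ℝ³) (q : ℝ → ℝ³ → ℝ) (G : ℝ → ℝ³ → ℝ),
    IsNormalForm ν C 2 M N w π K → HasFlatEnstrophy A w K → IsScalingLimit μ w π K v q G →
    IsWitness ν C 2 v q G

/-- S4 — ROTATING-WAVE REDUCTION (OPEN; the line's bet, hardest). -/
def RotatingWaveReduction : Prop :=
  ∀ (ν C M A : ℝ) (N : ℕ) (w : ℝ → ℝ³ → ℝ³) (π : ℝ → ℝ³ → ℝ) (K : ℝ → ℝ³ → ℝ),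
    IsNormalForm ν C 2 M N w π K → HasFlatEnstrophy A w K → HeadLaw ν w π K →
    ∃ (μ : ℕ → ℝ) (α : ℝ) (U₀ : ℝ³ → ℝ³) (v : ℝ → ℝ³ → ℝ³) (q : ℝ → ℝ³ → ℝ) (G : ℝ → ℝ³ → ℝ),
      IsScalingLimit μ w π K v q G ∧ IsRotatingWave α U₀ v

/-- S5 — SELF-SIMILAR LEAF (provable, M). -/
def SelfSimilarLeaf : Prop :=
  ∀ (ν C Λ₀ : ℝ) (U₀ : ℝ³ → ℝ³) (v : ℝ → ℝ³ → ℝ³) (q : ℝ → ℝ³ → ℝ) (K : ℝ → ℝ³ → ℝ),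
    IsWitness ν C Λ₀ v q K → IsRotatingWave 0 U₀ v → False

/-- S6 — ROTATED LEAF (OPEN wall: bounded-profile RSS Liouville, every `α ≠ 0`). -/
def RotatedLeaf : Prop :=
  ∀ (ν C Λ₀ α : ℝ) (U₀ : ℝ³ → ℝ³) (v : ℝ → ℝ³ → ℝ³) (q : ℝ → ℝ³ → ℝ) (K : ℝ → ℝ³ → ℝ),
    IsWitness ν C Λ₀ v q K → α ≠ 0 → IsRotatingWave α U₀ v → False

/-- Readable alias of the crux, used as the conclusion of the statement-level composition theorem so that
`FrequencyRigidity_of` is the only theorem of this file concluding the crux by name. -/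
def Crux : Prop :=
  Summit.NavierStokesRegularity.NavierStokesRegularity.Theses.AdaptedFrequency.FrequencyRigidity

/-! ## Registered stubs (signatures over tree declarations only; the only `sorry`s of the line) -/

/-- stub S1 `NormalFormExists` (provable, size L).  Every witness `(ν, C, Λ₀, v, q, K)` of the `∃`-body
yields a NORMAL-FORM witness with the same `ν`, `Λ₀`: (i) a bounded classical solution on each slab is
`v = w(x − B(t), t) + B′(t)` with `w` mild (harmonic part of `∇q` is `x`-independent: KNSS 2009 §5, tree
`KNSSRegularityGalilean`, `AncientMildRepresentative`); the CENTRED comparable kernel forces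
`|B(t)| ≲ √(−t)` at both ends, so `K′(t,y) = K(t, y + B(t))` is again adapted, comparable and
concentrating at `0`, `H_w = H_v` (vorticity is wobble-blind), and `‖w‖ ≤ C′/√(−t)`; (ii) the mild pressure
`π = RᵢRⱼ(wᵢwⱼ) + c(t)` in the kernel-mean-zero gauge `∫π(t)K′(t) = 0` (`c` smooth: `K′` is smooth by
parabolic regularity); (iii) KNSS smoothing on parabolic slabs gives the scale-invariant bounds
`(−t)^{(1+k)/2}|∇ᵏw| ≤ M_k`, Calderón–Zygmund gives `(−t)|π| + (−t)^{3/2}|∇π| + (−t)²|∂ₜπ| ≲ (1+log)` growth;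
(iv) `H` is `C¹` (cut-off `χ_R`, adjoint clause + IBP put all derivatives on `|ω|²χ_R`; only the kernel's
upper bound is needed).  Sources: KochNadirashviliSereginSverak2009 §4–5 (arXiv:0709.3599); Seregin2014Notes
§6; LemarieRieusset2016 Ch. 10–11; tree `KNSSMildGradientBound`, `AncientMildModification`,
`SereginSverakTypeIConsequences`; triage findings G6 (r1-3) / 1 (r1-2); negatives index stmt-4055 (why the
gauge must be fixed). -/
theorem stub_normalForm :
    ∀ (ν C Λ₀ : ℝ) (v : ℝ → EuclideanSpace ℝ (Fin 3) → EuclideanSpace ℝ (Fin 3))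
      (q : ℝ → EuclideanSpace ℝ (Fin 3) → ℝ) (K : ℝ → EuclideanSpace ℝ (Fin 3) → ℝ),
      (0 < ν ∧ Literature.Analysis.FluidPDE.IsClassicalNSSolutionOn (Set.Iio 0) ν 0 v q ∧
        Literature.Analysis.FluidPDE.HasTypeITimeDecay C v ∧
        Literature.Analysis.FluidPDE.IsAdaptedBackwardKernel ν v (Set.Iio 0) 0 0 K ∧
        Literature.Analysis.FluidPDE.IsGaussianComparable K (Set.Iio 0) 0 0 ∧
        (∀ t < 0, 0 < Literature.Analysis.FluidPDE.adaptedEnstrophy v K t) ∧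
        (∀ t < 0, Literature.Analysis.FluidPDE.adaptedFrequency v K 0 t = Λ₀)) →
      ∃ (C' M : ℝ) (N : ℕ) (w : ℝ → EuclideanSpace ℝ (Fin 3) → EuclideanSpace ℝ (Fin 3))
        (π : ℝ → EuclideanSpace ℝ (Fin 3) → ℝ) (K' : ℝ → EuclideanSpace ℝ (Fin 3) → ℝ),
        ((0 < ν ∧ Literature.Analysis.FluidPDE.IsClassicalNSSolutionOn (Set.Iio 0) ν 0 w π ∧
            Literature.Analysis.FluidPDE.HasTypeITimeDecay C' w ∧
            Literature.Analysis.FluidPDE.IsAdaptedBackwardKernel ν w (Set.Iio 0) 0 0 K' ∧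
            Literature.Analysis.FluidPDE.IsGaussianComparable K' (Set.Iio 0) 0 0 ∧
            (∀ t < 0, 0 < Literature.Analysis.FluidPDE.adaptedEnstrophy w K' t) ∧
            (∀ t < 0, Literature.Analysis.FluidPDE.adaptedFrequency w K' 0 t = Λ₀)) ∧
          (∀ t < 0, ∀ x,
            ‖Literature.Analysis.FluidPDE.curl (w t) x‖ ≤ M / (-t) ∧
            Real.sqrt (-t) * ‖w t x‖ + (-t) * ‖fderiv ℝ (w t) x‖ +
                (-t) * Real.sqrt (-t) * (‖iteratedFDeriv ℝ 2 (w t) x‖ +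
                  ‖Literature.Analysis.FluidPDE.timeDerivWithin (Set.Iio 0) w t x‖) +
                (-t) * |π t x| + (-t) * Real.sqrt (-t) * ‖fderiv ℝ (π t) x‖ +
                (-t) ^ 2 * |Literature.Analysis.FluidPDE.timeDerivWithin (Set.Iio 0) π t x|
              ≤ M * (1 + ‖x‖ / Real.sqrt (-t)) ^ N) ∧
          (∀ t < 0, ∫ x, π t x * K' t x = 0) ∧
          (∀ t < 0, DifferentiableAt ℝ (Literature.Analysis.FluidPDE.adaptedEnstrophy w K') t)) := by
  sorry

/-- stub S2 `MovingAdjointBernoulli` (provable, size M–L) — THE LEVER.  For a classical Navier–Stokes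
pair `(w, π)` on `(−∞,0)`, an adapted Gaussian-comparable kernel `K` at `(0,0)` and the scale-invariant
growth bounds, the kernel-mean head `∫(½|w|² + π)K` is differentiable with
`d/dt ∫(½|w|²+π)K = −ν ∫|curl w|²K + ∫(∂ₜπ)K`.  Pointwise: `(∂ₜ + w·∇ − νΔ)(½|w|² + π) = ∂ₜπ − ν|curl w|²`
(momentum equation dotted with `w`; `Δπ = −tr((∇w)²) = |curl w|² − |∇w|²`); pairing: for every density `f`
of polynomial growth, `d/dt ∫ f K = ∫ (∂ₜf + w·∇f − νΔf) K` by the adjoint clause `∂ₜK + w·∇K + νΔK = 0`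
and whole-space integration by parts (`div w = 0`), proved through cut-offs `χ_R` (only the two-sided
Gaussian bound on `K` and joint `C²` are available, no bounds on `∇K`): differentiate `∫ fχ_R K`, move all
derivatives onto `fχ_R`, let `R → ∞` locally uniformly in `t` (`hasDerivAt_of_tendstoLocallyUniformlyOn`).
Verified by hand by all three triagers (r1-1 S5, r1-2 ID1/ID1b kit j010236, r1-3 G4-I1/I4 kit j010223).
Sources: Tsai1998 (1.7); NecasRuzickaSverak1996 §3; PineauVicol2026 (7.7) (arXiv:2607.09619; tree
`PineauVicol2026.bernoulli_identity_rdss`, `driftOp_headPressure_forced`, `IsLerayProfile.driftOp_headPressure_eq_half_sum_sq`);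
Friedman1964 Ch. 1 §8 (adjoint fundamental solutions); ConstantinIyer2007 §2; tree `WholeSpaceIBP`,
`PineauVicolWeightedIdentity.integral_weight_mul_drift_eq_zero` (pattern), `norm_curl_sq_eq_sum`. -/
theorem stub_movingAdjointBernoulli :
    ∀ (ν M : ℝ) (N : ℕ) (w : ℝ → EuclideanSpace ℝ (Fin 3) → EuclideanSpace ℝ (Fin 3))
      (π : ℝ → EuclideanSpace ℝ (Fin 3) → ℝ) (K : ℝ → EuclideanSpace ℝ (Fin 3) → ℝ), 0 < ν →
      Literature.Analysis.FluidPDE.IsClassicalNSSolutionOn (Set.Iio 0) ν 0 w π →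
      Literature.Analysis.FluidPDE.IsAdaptedBackwardKernel ν w (Set.Iio 0) 0 0 K →
      Literature.Analysis.FluidPDE.IsGaussianComparable K (Set.Iio 0) 0 0 →
      (∀ t < 0, ∀ x,
        ‖Literature.Analysis.FluidPDE.curl (w t) x‖ ≤ M / (-t) ∧
        Real.sqrt (-t) * ‖w t x‖ + (-t) * ‖fderiv ℝ (w t) x‖ +
            (-t) * Real.sqrt (-t) * (‖iteratedFDeriv ℝ 2 (w t) x‖ +
              ‖Literature.Analysis.FluidPDE.timeDerivWithin (Set.Iio 0) w t x‖) +
            (-t) * |π t x| + (-t) * Real.sqrt (-t) * ‖fderiv ℝ (π t) x‖ +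
            (-t) ^ 2 * |Literature.Analysis.FluidPDE.timeDerivWithin (Set.Iio 0) π t x|
          ≤ M * (1 + ‖x‖ / Real.sqrt (-t)) ^ N) →
      ∀ t < 0, HasDerivAt (fun τ => ∫ x, (2⁻¹ * ‖w τ x‖ ^ 2 + π τ x) * K τ x)
        (-ν * Literature.Analysis.FluidPDE.adaptedEnstrophy w K t +
          ∫ x, Literature.Analysis.FluidPDE.timeDerivWithin (Set.Iio 0) π t x * K t x) t := by
  sorry

/-- stub S3 `ScalingClosure` (provable, size L) — Type-I compactness bookkeeping.  The rescalings
`(μ w(μ²t, μx), μ² π(μ²t, μx), μ³ K(μ²t, μx))` of a normal-form witness are normal-form witnesses with the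
SAME constants (`ν`, Type-I `C`, `M`, `N`, comparability `c₁,c₂,C₁,C₂`, and flat `H = A(−t)⁻²` because
`H_μ(t) = μ⁴H(μ²t)`); the bounds are uniform, so a slice-wise locally uniform limit `(v, q, G)` along ANY
positive scales is again: jointly smooth and classical Navier–Stokes (uniform `C^{2,1}` bounds ⇒ the limit
solves NS with pressure `q`; bounded weak solutions are smooth, the kernel gauge fixes the `t`-dependence),
Type-I with constant `C`, with `G` a `C²` (parabolic interior estimates, uniform in `n`) positive solution of
the adjoint equation for `v`, unit mass and concentration at `0` (Gaussian sandwich + dominated convergence: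
`|∫(φ − φ(0))G(t)| → 0`), comparable with the same constants (pointwise limits), and
`∫‖curl v‖²G = lim = A(−t)⁻² > 0` (dominated convergence: `|curl w_n| ≤ M/(−t)`, Gaussian upper bound),
whence `Λ ≡ 2`.  Sources: KochNadirashviliSereginSverak2009 §4 (smoothing, compactness; tree
`KNSS2009_regularity_boundedWeak_window_holds`); AlbrittonBarker2019 §2 (arXiv:1811.00502); SereginSverak2009;
LadyzhenskayaSolonnikovUraltseva1968 Ch. IV (interior Schauder); the route's own `TangentFlowTransfer`
(stmt-10494) is the same bookkeeping at the blow-up point. -/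
theorem stub_scalingClosure :
    ∀ (ν C M A : ℝ) (N : ℕ) (μ : ℕ → ℝ) (w : ℝ → EuclideanSpace ℝ (Fin 3) → EuclideanSpace ℝ (Fin 3))
      (π : ℝ → EuclideanSpace ℝ (Fin 3) → ℝ) (K : ℝ → EuclideanSpace ℝ (Fin 3) → ℝ)
      (v : ℝ → EuclideanSpace ℝ (Fin 3) → EuclideanSpace ℝ (Fin 3))
      (q : ℝ → EuclideanSpace ℝ (Fin 3) → ℝ) (G : ℝ → EuclideanSpace ℝ (Fin 3) → ℝ),
      ((0 < ν ∧ Literature.Analysis.FluidPDE.IsClassicalNSSolutionOn (Set.Iio 0) ν 0 w π ∧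
            Literature.Analysis.FluidPDE.HasTypeITimeDecay C w ∧
            Literature.Analysis.FluidPDE.IsAdaptedBackwardKernel ν w (Set.Iio 0) 0 0 K ∧
            Literature.Analysis.FluidPDE.IsGaussianComparable K (Set.Iio 0) 0 0 ∧
            (∀ t < 0, 0 < Literature.Analysis.FluidPDE.adaptedEnstrophy w K t) ∧
            (∀ t < 0, Literature.Analysis.FluidPDE.adaptedFrequency w K 0 t = 2)) ∧
          (∀ t < 0, ∀ x,
            ‖Literature.Analysis.FluidPDE.curl (w t) x‖ ≤ M / (-t) ∧
            Real.sqrt (-t) * ‖w t x‖ + (-t) * ‖fderiv ℝ (w t) x‖ +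
                (-t) * Real.sqrt (-t) * (‖iteratedFDeriv ℝ 2 (w t) x‖ +
                  ‖Literature.Analysis.FluidPDE.timeDerivWithin (Set.Iio 0) w t x‖) +
                (-t) * |π t x| + (-t) * Real.sqrt (-t) * ‖fderiv ℝ (π t) x‖ +
                (-t) ^ 2 * |Literature.Analysis.FluidPDE.timeDerivWithin (Set.Iio 0) π t x|
              ≤ M * (1 + ‖x‖ / Real.sqrt (-t)) ^ N) ∧
          (∀ t < 0, ∫ x, π t x * K t x = 0) ∧
          (∀ t < 0, DifferentiableAt ℝ (Literature.Analysis.FluidPDE.adaptedEnstrophy w K) t)) →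
      (0 < A ∧ ∀ t < 0, Literature.Analysis.FluidPDE.adaptedEnstrophy w K t = A * (-t) ^ (-(2:ℝ))) →
      ((∀ n, 0 < μ n) ∧
        (∀ t < 0, TendstoLocallyUniformly
          (fun (n : ℕ) (x : EuclideanSpace ℝ (Fin 3)) => μ n • w (μ n ^ 2 * t) (μ n • x)) (v t)
          Filter.atTop) ∧
        (∀ t < 0, TendstoLocallyUniformly
          (fun (n : ℕ) (x : EuclideanSpace ℝ (Fin 3)) => μ n ^ 2 * π (μ n ^ 2 * t) (μ n • x)) (q t)
          Filter.atTop) ∧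
        (∀ t < 0, TendstoLocallyUniformly
          (fun (n : ℕ) (x : EuclideanSpace ℝ (Fin 3)) => μ n ^ 3 * K (μ n ^ 2 * t) (μ n • x)) (G t)
          Filter.atTop)) →
      (0 < ν ∧ Literature.Analysis.FluidPDE.IsClassicalNSSolutionOn (Set.Iio 0) ν 0 v q ∧
        Literature.Analysis.FluidPDE.HasTypeITimeDecay C v ∧
        Literature.Analysis.FluidPDE.IsAdaptedBackwardKernel ν v (Set.Iio 0) 0 0 G ∧
        Literature.Analysis.FluidPDE.IsGaussianComparable G (Set.Iio 0) 0 0 ∧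
        (∀ t < 0, 0 < Literature.Analysis.FluidPDE.adaptedEnstrophy v G t) ∧
        (∀ t < 0, Literature.Analysis.FluidPDE.adaptedFrequency v G 0 t = 2)) := by
  sorry

/-- stub S4 `RotatingWaveReduction` (OPEN — the line's bet; hardest, load-bearing).  A normal-form witness
with flat enstrophy `H = A(−t)⁻²` obeying the head law has a scaling limit (along SOME positive scales
`μₙ` — far past `μₙ → ∞`, singular time `μₙ → 0`, or constant) which is a rotating wave
`v∞(t,x) = (−t)^{−1/2} R(αs) U₀(R(−αs)x/√(−t))`, `s = −log(−t)` (`pvAnsatz α U₀`).  Intended route: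
(1) SECULAR PRESSURE-WORK LAW (provable, M): in similarity variables the head law reads
`d/ds⟨½|U|² + P + ½y·U⟩_𝔎 = −ν𝓗 + ⟨∂ₛP⟩_𝔎` with bounded left-hand bracket (Type I + kernel gauge), so on a
flat witness the log-time Cesàro mean of `⟨∂ₛP⟩_𝔎` is EXACTLY `νA > 0` at both ends `s → ±∞` — pressure
must do secular work against the kernel's own motion forever (steady kernel ⇒ `A = 0`: Tsai/NRŠ in one
line; one-instant-steady slice ⇒ bounded Leray profile ⇒ `𝓗(s₀) = 0 ≠ A`); (2) UNIFORM UNSTEADINESS: by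
kernel fading memory (sibling card `kernel-fading-memory`: `‖∂ₛ log 𝔎‖_{L²(𝔎)} ≲` fading average of the
future unsteadiness `‖∂ₛU‖`) every window of length `L(C)` carries unsteadiness `≥ u₀(ν,C,A) > 0`;
(3) COMPACTNESS: Type-I compactness makes the translation hull of the witness compact with a minimal
(uniformly recurrent) element, again flat with the same `A` (S3); (4) RIGIDITY (the bet proper): on a
minimal flat element the only kernel motion that changes no kernel enstrophy at ANY instant
(`𝒮 − ν𝒫 = 𝓗 ≡ A`, the torque-gauged instantaneous laws of `rotation-gauged-head`) is rigid rotation about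
the pole, i.e. the element is a rotating wave.  Implied by the crux (vacuously); with S3, S5, S6 it implies
the crux.  Sources: this line's card + Ideator2Derivations (F3)–(F5); rotation-gauged-head
(`Ideator1TorqueProof.lean`: `torqueLaw`, `rotatingBernoulliIdentity`, Lean-proved); analogues GigaKohn1985,
EndersMullerTopping2011 (arXiv:1005.1624), MerleZaag1998 (Liouville/ODE behaviour of ancient solutions in
similarity variables); PineauVicol2026 Thm 1.9 (one slow slice ⇒ regular, tree
`pineauVicol2026_oneSlice_regularity_holds`); what a counterexample is: a Type-I ancient flow with flat
adapted enstrophy whose scaling limits are all non-rotating (e.g. genuinely DSS with exactly constant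
`(−t)²H` — BradshawTsai2017CPDE OP 5.1/5.2, ChaeWolf2017RemovingDSS Thm 1.3). -/
theorem stub_rotatingWaveReduction :
    ∀ (ν C M A : ℝ) (N : ℕ) (w : ℝ → EuclideanSpace ℝ (Fin 3) → EuclideanSpace ℝ (Fin 3))
      (π : ℝ → EuclideanSpace ℝ (Fin 3) → ℝ) (K : ℝ → EuclideanSpace ℝ (Fin 3) → ℝ),
      ((0 < ν ∧ Literature.Analysis.FluidPDE.IsClassicalNSSolutionOn (Set.Iio 0) ν 0 w π ∧
            Literature.Analysis.FluidPDE.HasTypeITimeDecay C w ∧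
            Literature.Analysis.FluidPDE.IsAdaptedBackwardKernel ν w (Set.Iio 0) 0 0 K ∧
            Literature.Analysis.FluidPDE.IsGaussianComparable K (Set.Iio 0) 0 0 ∧
            (∀ t < 0, 0 < Literature.Analysis.FluidPDE.adaptedEnstrophy w K t) ∧
            (∀ t < 0, Literature.Analysis.FluidPDE.adaptedFrequency w K 0 t = 2)) ∧
          (∀ t < 0, ∀ x,
            ‖Literature.Analysis.FluidPDE.curl (w t) x‖ ≤ M / (-t) ∧
            Real.sqrt (-t) * ‖w t x‖ + (-t) * ‖fderiv ℝ (w t) x‖ +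
                (-t) * Real.sqrt (-t) * (‖iteratedFDeriv ℝ 2 (w t) x‖ +
                  ‖Literature.Analysis.FluidPDE.timeDerivWithin (Set.Iio 0) w t x‖) +
                (-t) * |π t x| + (-t) * Real.sqrt (-t) * ‖fderiv ℝ (π t) x‖ +
                (-t) ^ 2 * |Literature.Analysis.FluidPDE.timeDerivWithin (Set.Iio 0) π t x|
              ≤ M * (1 + ‖x‖ / Real.sqrt (-t)) ^ N) ∧
          (∀ t < 0, ∫ x, π t x * K t x = 0) ∧
          (∀ t < 0, DifferentiableAt ℝ (Literature.Analysis.FluidPDE.adaptedEnstrophy w K) t)) →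
      (0 < A ∧ ∀ t < 0, Literature.Analysis.FluidPDE.adaptedEnstrophy w K t = A * (-t) ^ (-(2:ℝ))) →
      (∀ t < 0, HasDerivAt (fun τ => ∫ x, (2⁻¹ * ‖w τ x‖ ^ 2 + π τ x) * K τ x)
        (-ν * Literature.Analysis.FluidPDE.adaptedEnstrophy w K t +
          ∫ x, Literature.Analysis.FluidPDE.timeDerivWithin (Set.Iio 0) π t x * K t x) t) →
      ∃ (μ : ℕ → ℝ) (α : ℝ) (U₀ : EuclideanSpace ℝ (Fin 3) → EuclideanSpace ℝ (Fin 3))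
        (v : ℝ → EuclideanSpace ℝ (Fin 3) → EuclideanSpace ℝ (Fin 3))
        (q : ℝ → EuclideanSpace ℝ (Fin 3) → ℝ) (G : ℝ → EuclideanSpace ℝ (Fin 3) → ℝ),
        ((∀ n, 0 < μ n) ∧
          (∀ t < 0, TendstoLocallyUniformly
            (fun (n : ℕ) (x : EuclideanSpace ℝ (Fin 3)) => μ n • w (μ n ^ 2 * t) (μ n • x)) (v t)
            Filter.atTop) ∧
          (∀ t < 0, TendstoLocallyUniformly
            (fun (n : ℕ) (x : EuclideanSpace ℝ (Fin 3)) => μ n ^ 2 * π (μ n ^ 2 * t) (μ n • x)) (q t)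
            Filter.atTop) ∧
          (∀ t < 0, TendstoLocallyUniformly
            (fun (n : ℕ) (x : EuclideanSpace ℝ (Fin 3)) => μ n ^ 3 * K (μ n ^ 2 * t) (μ n • x)) (G t)
            Filter.atTop)) ∧
        (∀ t < 0, ∀ x, v t x = Literature.Analysis.FluidPDE.pvAnsatz α (fun y _ => U₀ y) t x) := by
  sorry

/-- stub S5 `SelfSimilarLeaf` (provable, size M).  A witness that is exactly backward self-similar about
the pole (`v = pvAnsatz 0 U₀`, i.e. `v(t,x) = (−t)^{−1/2} U₀(x/√(−t))`, `rotZ 0 = id`) cannot exist: `U₀`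
is bounded by `C` and smooth (slice `t = −1`), `(U₀, q(−1,·))` is a Leray profile with `a = ½`
(`lerayBackward`/`lerayBackward_isClassical_iff` dictionary, `λ(t) = (−t)^{−1/2}`), hence `U₀ ≡ c` by
Tsai 1998 Thm 1 (`q = ∞`; tree theorem `tsai_selfsimilar_bounded_holds`), so `curl v ≡ 0` and `H ≡ 0`,
contradicting `H > 0`.  (Alternative proof inside the line: the adapted kernel of a self-similar flow may be
taken steady in similarity variables — invariant density of `U₀ + ½y` — and then S2 integrates to
`ν∫𝓗 ds < ∞`, impossible for `𝓗 ≡ A > 0`; or pair Tsai's identity (1.7) with that density: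
`∫|curl U₀|²ρ = 0`.)  Sources: Tsai1998 Thm 1; NecasRuzickaSverak1996; Leray1934 (3.11)–(3.12); tree
`tsai_selfsimilar_bounded_holds`, `IsLerayProfile`, `lerayBackward_isClassical_iff`, `rotZ_zero`. -/
theorem stub_selfSimilarLeaf :
    ∀ (ν C Λ₀ : ℝ) (U₀ : EuclideanSpace ℝ (Fin 3) → EuclideanSpace ℝ (Fin 3))
      (v : ℝ → EuclideanSpace ℝ (Fin 3) → EuclideanSpace ℝ (Fin 3))
      (q : ℝ → EuclideanSpace ℝ (Fin 3) → ℝ) (K : ℝ → EuclideanSpace ℝ (Fin 3) → ℝ),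
      (0 < ν ∧ Literature.Analysis.FluidPDE.IsClassicalNSSolutionOn (Set.Iio 0) ν 0 v q ∧
        Literature.Analysis.FluidPDE.HasTypeITimeDecay C v ∧
        Literature.Analysis.FluidPDE.IsAdaptedBackwardKernel ν v (Set.Iio 0) 0 0 K ∧
        Literature.Analysis.FluidPDE.IsGaussianComparable K (Set.Iio 0) 0 0 ∧
        (∀ t < 0, 0 < Literature.Analysis.FluidPDE.adaptedEnstrophy v K t) ∧
        (∀ t < 0, Literature.Analysis.FluidPDE.adaptedFrequency v K 0 t = Λ₀)) →
      (∀ t < 0, ∀ x, v t x = Literature.Analysis.FluidPDE.pvAnsatz 0 (fun y _ => U₀ y) t x) →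
      False := by
  sorry

/-- stub S6 `RotatedLeaf` (OPEN — the wall shared by every line on this crux).  A witness that is a
backward ROTATED self-similar flow about the pole with `α ≠ 0` (`v = pvAnsatz α U₀`; `U₀` bounded by `C`,
smooth) cannot exist — Liouville for bounded Type-I RSS profiles at every rotation speed: Pineau–Vicol 2026
Conj. 1.1 (= Tsai GSM192 Conj. 8.9 = BradshawTsai2017CPDE OP 5.2) in the LARGER bounded-profile class
(their Thm 1.4, tree named fact `pineauVicol2026_rss_liouville`, needs the decaying bound `C/(|x|+√(−t))`
and `|α| < α₁(C)` or `|α| > α₂(C)`).  The line's entry: in the co-rotating similarity frame the kernel may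
be taken co-rotating (kernel uniqueness, sibling `kernel-fading-memory`), S2 becomes the TORQUE form
`ν𝓗₀ = −α⟨∂_θP⟩_𝔎` (PV (5.4) with the dynamic weight), and the rotation-gauged head
(`rotatingBernoulliIdentity_rss`, Lean-proved in `Ideator1TorqueProof.lean`) gives the defect-free variance
identity `∫|Ω − αe₃|²𝔎 = α²`, hence `𝓗₀ ≤ 4α²` — small `|α|` closes given an enstrophy-gap lemma for the
bounded class (PV Prop. 3.1 transplanted); `α ≈ 1` is open.  A bounded backward RSS profile with `α` in
PV's window refutes this stub AND the crux (it inhabits the `∃`-body with `Λ ≡ 2`).  Sources: PineauVicol2026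
arXiv:2607.09619 Thm 1.4, Conj. 1.1, §5 (5.4), Prop. 3.1; Tsai2018 Conj. 8.9; BradshawTsai2017CPDE OP 5.2;
ChaeWolf2017RemovingDSS; tree `pvAnsatz`, `pineauVicol2026_rss_liouville`, `RotatedTypeIDSSLiouville`. -/
theorem stub_rotatedLeaf :
    ∀ (ν C Λ₀ α : ℝ) (U₀ : EuclideanSpace ℝ (Fin 3) → EuclideanSpace ℝ (Fin 3))
      (v : ℝ → EuclideanSpace ℝ (Fin 3) → EuclideanSpace ℝ (Fin 3))
      (q : ℝ → EuclideanSpace ℝ (Fin 3) → ℝ) (K : ℝ → EuclideanSpace ℝ (Fin 3) → ℝ),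
      (0 < ν ∧ Literature.Analysis.FluidPDE.IsClassicalNSSolutionOn (Set.Iio 0) ν 0 v q ∧
        Literature.Analysis.FluidPDE.HasTypeITimeDecay C v ∧
        Literature.Analysis.FluidPDE.IsAdaptedBackwardKernel ν v (Set.Iio 0) 0 0 K ∧
        Literature.Analysis.FluidPDE.IsGaussianComparable K (Set.Iio 0) 0 0 ∧
        (∀ t < 0, 0 < Literature.Analysis.FluidPDE.adaptedEnstrophy v K t) ∧
        (∀ t < 0, Literature.Analysis.FluidPDE.adaptedFrequency v K 0 t = Λ₀)) →
      α ≠ 0 →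
      (∀ t < 0, ∀ x, v t x = Literature.Analysis.FluidPDE.pvAnsatz α (fun y _ => U₀ y) t x) →
      False := by
  sorry

/-! ## Pinning — the Disproof's CHECKED theorems (T), copied verbatim

Source: `Cruxes/FrequencyRigidity/Disproof.lean` §(T) (refuter `refuter-cdisprove-stmt-NavierStokesRegularity-2955-0`,
v3 @ tree commit b1b50a35c3b0, `lean check` rc 0, no `sorry`).  Same names, same statements, same proofs
(namespace `…MovingAdjointBernoulli.Pinning` instead of `…Disproof`); nothing here is claimed by this line. -/

namespace Pinning

/-- The frequency clause of the crux: positive adapted enstrophy AND constant adapted frequency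
`Λ₀` (verbatim, with the `∀ H Λ, H = … → Λ = … →` binders).  [Disproof.lean, `FreqClause`] -/
def FreqClause (v : ℝ → ℝ³ → ℝ³) (K : ℝ → ℝ³ → ℝ) (Λ₀ : ℝ) : Prop :=
  ∀ H Λ : ℝ → ℝ, H = (fun t => ∫ x, ‖curl (v t) x‖ ^ 2 * K t x) →
    Λ = (fun t => (0 - t) * deriv H t / H t) →
      (∀ t ∈ Iio (0:ℝ), 0 < H t) ∧ (∀ t ∈ Iio (0:ℝ), Λ t = Λ₀)

/-- **Constant frequency ⇔ exact power law.**  If the frequency clause holds with constant `Λ₀`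
and the adapted enstrophy `H` is differentiable on `(−∞,0)`, then `H(t) = H(−1) · (−t)^{−Λ₀}` for every
`t < 0`.  [Disproof.lean, `FreqClause.power_law`] -/
theorem FreqClause.power_law {v : ℝ → ℝ³ → ℝ³} {K : ℝ → ℝ³ → ℝ} {Λ₀ : ℝ}
    (h : FreqClause v K Λ₀)
    (hd : ∀ t < 0, DifferentiableAt ℝ (fun t => ∫ x, ‖curl (v t) x‖ ^ 2 * K t x) t)
    {t : ℝ} (ht : t < 0) :
    (∫ x, ‖curl (v t) x‖ ^ 2 * K t x) =
      (∫ x, ‖curl (v (-1)) x‖ ^ 2 * K (-1) x) * (-t) ^ (-Λ₀) := by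
  set H : ℝ → ℝ := fun t => ∫ x, ‖curl (v t) x‖ ^ 2 * K t x with hH
  have hcl := h H _ rfl rfl
  -- the ODE `(−s) H'(s) = Λ₀ H(s)` on `s < 0`
  have hode : ∀ s < 0, (0 - s) * deriv H s = Λ₀ * H s := fun s hs => by
    have h1 := hcl.2 s hs
    have hpos := hcl.1 s hs
    field_simp at h1
    linarith [h1]
  -- `G s = H s * (−s)^Λ₀` has zero derivative on `(−∞,0)`
  set G : ℝ → ℝ := fun s => H s * (-s) ^ Λ₀ with hG
  have hGd : ∀ s < 0, HasDerivAt G 0 s := fun s hs => by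
    have hHs : HasDerivAt H (deriv H s) s := (hd s hs).hasDerivAt
    have hps : HasDerivAt (fun r : ℝ => (-r) ^ Λ₀) ((-1) * Λ₀ * (-s) ^ (Λ₀ - 1)) s :=
      (hasDerivAt_neg s).rpow_const (Or.inl (by linarith))
    have := hHs.mul hps
    refine this.congr_deriv ?_
    have hs' : (-s) ^ Λ₀ = (-s) ^ (Λ₀ - 1) * (-s) := by
      rw [← Real.rpow_add_one (by linarith : (-s) ≠ 0), sub_add_cancel]
    rw [hs']
    linear_combination (-s) ^ (Λ₀ - 1) * hode s hs
  have hGconst : G t = G (-1) :=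
    IsOpen.is_const_of_deriv_eq_zero isOpen_Iio (convex_Iio 0).isPreconnected
      (fun s hs => (hGd s hs).differentiableAt.differentiableWithinAt)
      (fun s hs => (hGd s hs).deriv) ht (by norm_num)
  have hG1 : G (-1) = H (-1) := by simp [hG]
  have hpow : (-t) ^ Λ₀ * (-t) ^ (-Λ₀) = 1 := by
    rw [Real.rpow_neg (by linarith), mul_inv_cancel₀]
    exact (Real.rpow_pos_of_pos (by linarith) _).ne'
  calc H t = G t * (-t) ^ (-Λ₀) := by simp only [hG]; rw [mul_assoc, hpow, mul_one]
    _ = H (-1) * (-t) ^ (-Λ₀) := by rw [hGconst, hG1]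

/-- Power-law comparison near `s → 0⁺`: `A s^{−Λ₀} ≤ M s^{−2}` on `(0,1)` with `A > 0` forces
`Λ₀ ≤ 2`.  [Disproof.lean, `exponent_le_two_of_bound_near_zero`] -/
theorem exponent_le_two_of_bound_near_zero {A M Λ₀ : ℝ} (hA : 0 < A)
    (h : ∀ s ∈ Ioo (0:ℝ) 1, A * s ^ (-Λ₀) ≤ M * s ^ (-(2:ℝ))) : Λ₀ ≤ 2 := by
  by_contra hΛ'
  have hΛ : 2 < Λ₀ := not_le.mp hΛ'
  have ht := tendsto_rpow_atTop (show 0 < Λ₀ - 2 by linarith)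
  obtain ⟨N, hN1, hN⟩ := ((eventually_gt_atTop (1:ℝ)).and (ht.eventually_gt_atTop (M / A))).exists
  have hN0 : 0 < N := by linarith
  have hs : N⁻¹ ∈ Ioo (0:ℝ) 1 := ⟨inv_pos.2 hN0, inv_lt_one_of_one_lt₀ hN1⟩
  have h1 := h _ hs
  rw [Real.inv_rpow hN0.le, Real.inv_rpow hN0.le, Real.rpow_neg hN0.le, Real.rpow_neg hN0.le,
    inv_inv, inv_inv] at h1
  have h2 : N ^ (Λ₀ - 2) * N ^ (2:ℝ) = N ^ Λ₀ := by
    rw [← Real.rpow_add hN0, sub_add_cancel]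
  have h3 : 0 < N ^ (2:ℝ) := Real.rpow_pos_of_pos hN0 _
  have h4 : M / A < N ^ (Λ₀ - 2) := hN
  rw [div_lt_iff₀ hA] at h4
  nlinarith [mul_lt_mul_of_pos_right h4 h3]

/-- Power-law comparison near `s → ∞`: `A s^{−Λ₀} ≤ M s^{−2}` on `(1,∞)` with `A > 0` forces
`2 ≤ Λ₀`.  [Disproof.lean, `two_le_exponent_of_bound_near_infty`] -/
theorem two_le_exponent_of_bound_near_infty {A M Λ₀ : ℝ} (hA : 0 < A)
    (h : ∀ s : ℝ, 1 < s → A * s ^ (-Λ₀) ≤ M * s ^ (-(2:ℝ))) : 2 ≤ Λ₀ := by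
  by_contra hΛ'
  have hΛ : Λ₀ < 2 := not_le.mp hΛ'
  have ht := tendsto_rpow_atTop (show 0 < 2 - Λ₀ by linarith)
  obtain ⟨N, hN1, hN⟩ := ((eventually_gt_atTop (1:ℝ)).and (ht.eventually_gt_atTop (M / A))).exists
  have hN0 : 0 < N := by linarith
  have h1 := h N hN1
  rw [Real.rpow_neg hN0.le, Real.rpow_neg hN0.le] at h1
  have h2 : N ^ (2 - Λ₀) * N ^ Λ₀ = N ^ (2:ℝ) := by
    rw [← Real.rpow_add hN0, sub_add_cancel]
  have h3 : 0 < N ^ Λ₀ := Real.rpow_pos_of_pos hN0 _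
  have h5 : 0 < N ^ (2:ℝ) := Real.rpow_pos_of_pos hN0 _
  have h4 : M / A < N ^ (2 - Λ₀) := hN
  rw [div_lt_iff₀ hA] at h4
  have h6 : A * N ^ (2:ℝ) ≤ M * N ^ Λ₀ := by
    have := h1
    rw [← div_eq_mul_inv, ← div_eq_mul_inv, div_le_div_iff₀ h3 h5] at this
    linarith
  nlinarith [mul_lt_mul_of_pos_right h4 h3]

/-- **The exponent is pinned to the self-similar value.**  If the frequency clause holds, the
adapted enstrophy is differentiable on `(−∞,0)` and obeys the two-ended bound `H(t) ≤ M (−t)^{−2}` for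
all `t < 0`, then `Λ₀ = 2`.  [Disproof.lean, `FreqClause.exponent_eq_two`] -/
theorem FreqClause.exponent_eq_two {v : ℝ → ℝ³ → ℝ³} {K : ℝ → ℝ³ → ℝ} {Λ₀ M : ℝ}
    (h : FreqClause v K Λ₀)
    (hd : ∀ t < 0, DifferentiableAt ℝ (fun t => ∫ x, ‖curl (v t) x‖ ^ 2 * K t x) t)
    (hM : ∀ t < 0, (∫ x, ‖curl (v t) x‖ ^ 2 * K t x) ≤ M * (-t) ^ (-(2:ℝ))) : Λ₀ = 2 := by
  set A : ℝ := ∫ x, ‖curl (v (-1)) x‖ ^ 2 * K (-1) x with hA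
  have hApos : 0 < A := (h _ _ rfl rfl).1 (-1) (by norm_num)
  have hlaw : ∀ s : ℝ, 0 < s → A * s ^ (-Λ₀) ≤ M * s ^ (-(2:ℝ)) := fun s hs => by
    have h1 := h.power_law hd (show -s < 0 by linarith)
    have h2 := hM (-s) (by linarith)
    rw [h1, neg_neg] at h2
    exact h2
  exact le_antisymm (exponent_le_two_of_bound_near_zero hApos fun s hs => hlaw s hs.1)
    (two_le_exponent_of_bound_near_infty hApos fun s hs => hlaw s (by linarith))

end Pinning

/-! ## Composition (real proofs, no `sorry` below this line) -/

/-- The inline `∃`-body of the crux is a witness in the tree's vocabulary. -/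
theorem isWitness_of_body {ν C Λ₀ : ℝ} {v : ℝ → ℝ³ → ℝ³} {q : ℝ → ℝ³ → ℝ} {K : ℝ → ℝ³ → ℝ}
    (hν : 0 < ν) (hcl : IsClassicalNSSolutionOn (Iio 0) ν 0 v q)
    (hTI : ∀ t ∈ Iio (0:ℝ), ∀ x, ‖v t x‖ ≤ C / Real.sqrt (-t))
    (hK₁ : ContDiffOn ℝ 2 (uncurry K) (Iio (0:ℝ) ×ˢ univ))
    (hK₂ : ∀ t ∈ Iio (0:ℝ), ∀ x, 0 < K t x)
    (hK₃ : ∀ t ∈ Iio (0:ℝ), ∀ x,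
      timeDerivWithin (Iio (0:ℝ)) K t x + fderiv ℝ (K t) x (v t x) + ν * Laplacian.laplacian (K t) x = 0)
    (hK₄ : ∀ t ∈ Iio (0:ℝ), ∫ x, K t x = 1)
    (hK₅ : ∀ φ : ℝ³ → ℝ, Continuous φ → (∃ M : ℝ, ∀ x, |φ x| ≤ M) →
      Tendsto (fun t => ∫ x, φ x * K t x) (𝓝[Iio (0:ℝ)] (0:ℝ)) (𝓝 (φ (0 : ℝ³))))
    (hcomp : ∃ c₁ c₂ C₁ C₂ : ℝ, 0 < c₁ ∧ 0 < c₂ ∧ 0 < C₁ ∧ 0 < C₂ ∧ ∀ t ∈ Iio (0:ℝ), ∀ x,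
      c₁ * ((0:ℝ) - t) ^ (-(3:ℝ) / 2) * Real.exp (-(‖x - (0 : ℝ³)‖ ^ 2) / (c₂ * ((0:ℝ) - t))) ≤ K t x ∧
        K t x ≤ C₁ * ((0:ℝ) - t) ^ (-(3:ℝ) / 2) * Real.exp (-(‖x - (0 : ℝ³)‖ ^ 2) / (C₂ * ((0:ℝ) - t))))
    (hfreq : ∀ H Λ : ℝ → ℝ, H = (fun t => ∫ x, ‖curl (v t) x‖ ^ 2 * K t x) →
      Λ = (fun t => (0 - t) * deriv H t / H t) →
        (∀ t ∈ Iio (0:ℝ), 0 < H t) ∧ (∀ t ∈ Iio (0:ℝ), Λ t = Λ₀)) :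
    IsWitness ν C Λ₀ v q K := by
  have hcl2 := hfreq _ _ rfl rfl
  refine ⟨hν, hcl, fun t ht x => hTI t ht x, ⟨hK₁, hK₂, hK₃, hK₄, hK₅⟩,
    isGaussianComparable_iff_fin_three.2 hcomp, fun t ht => ?_, fun t ht => ?_⟩
  · exact hcl2.1 t ht
  · exact hcl2.2 t ht

/-- A witness satisfies the Disproof's `FreqClause` (§Pinning), so the CHECKED pinning theorems (T) apply. -/
theorem freqClause_of_isWitness {ν C Λ₀ : ℝ} {v : ℝ → ℝ³ → ℝ³} {q : ℝ → ℝ³ → ℝ} {K : ℝ → ℝ³ → ℝ}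
    (h : IsWitness ν C Λ₀ v q K) : Pinning.FreqClause v K Λ₀ := by
  intro H Λ hH hΛ
  subst hH
  subst hΛ
  exact ⟨fun t ht => h.2.2.2.2.2.1 t ht, fun t ht => h.2.2.2.2.2.2 t ht⟩

/-- The two-ended scale-invariant ENSTROPHY bound of a normal-form witness: `H(t) ≤ M²(−t)⁻²`
(vorticity bound `‖curl w‖ ≤ M/(−t)` + positivity and unit mass of the kernel). -/
theorem enstrophy_le_of_normalForm {ν C Λ₀ M : ℝ} {N : ℕ} {w : ℝ → ℝ³ → ℝ³} {π : ℝ → ℝ³ → ℝ}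
    {K : ℝ → ℝ³ → ℝ} (h : IsNormalForm ν C Λ₀ M N w π K) :
    ∀ t < 0, (∫ x, ‖curl (w t) x‖ ^ 2 * K t x) ≤ M ^ 2 * (-t) ^ (-(2:ℝ)) := by
  intro t ht
  have hK : IsAdaptedBackwardKernel ν w (Iio 0) 0 0 K := h.1.2.2.2.1
  have ht' : t ∈ Iio (0:ℝ) := ht
  have hKpos : ∀ x, 0 < K t x := hK.pos t ht'
  have hint : Integrable (K t) := hK.integrable ht'
  have hcurl : ∀ x, ‖curl (w t) x‖ ≤ M / (-t) := fun x => (h.2.1 t ht x).1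
  have hpt : ∀ x, ‖curl (w t) x‖ ^ 2 * K t x ≤ (M / (-t)) ^ 2 * K t x := fun x =>
    mul_le_mul_of_nonneg_right (pow_le_pow_left₀ (norm_nonneg _) (hcurl x) 2) (hKpos x).le
  have hmass : ∫ x, K t x = 1 := hK.integral_eq_one t ht'
  calc (∫ x, ‖curl (w t) x‖ ^ 2 * K t x) ≤ ∫ x, (M / (-t)) ^ 2 * K t x := by
        refine integral_mono_of_nonneg (Eventually.of_forall fun x => ?_) (hint.const_mul _)
          (Eventually.of_forall hpt)
        exact mul_nonneg (sq_nonneg _) (hKpos x).le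
    _ = (M / (-t)) ^ 2 := by rw [integral_const_mul, hmass, mul_one]
    _ = M ^ 2 * (-t) ^ (-(2:ℝ)) := by
        rw [Real.rpow_neg (by linarith), Real.rpow_two, div_pow, div_eq_mul_inv]

/-- PINNING of a normal-form witness by the Disproof's theorems (T) (§Pinning): `Λ₀ = 2` and the adapted
enstrophy is flat, `H(t) = H(−1)(−t)⁻²` with `H(−1) > 0`. -/
theorem pinning_of_normalForm {ν C Λ₀ M : ℝ} {N : ℕ} {w : ℝ → ℝ³ → ℝ³} {π : ℝ → ℝ³ → ℝ}
    {K : ℝ → ℝ³ → ℝ} (h : IsNormalForm ν C Λ₀ M N w π K) :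
    Λ₀ = 2 ∧ HasFlatEnstrophy (adaptedEnstrophy w K (-1)) w K := by
  have hF : Pinning.FreqClause w K Λ₀ := freqClause_of_isWitness h.1
  have hd : ∀ t < 0, DifferentiableAt ℝ (fun t => ∫ x, ‖curl (w t) x‖ ^ 2 * K t x) t :=
    fun t ht => h.2.2.2 t ht
  have hM := enstrophy_le_of_normalForm h
  have hΛ : Λ₀ = 2 := Pinning.FreqClause.exponent_eq_two hF hd hM
  refine ⟨hΛ, h.1.2.2.2.2.2.1 (-1) (by norm_num), fun t ht => ?_⟩
  have hp := Pinning.FreqClause.power_law hF hd ht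
  rw [hΛ] at hp
  exact hp

/-- Statement-level composition: S1 → S2 → S3 → S4 → S5 → S6 → crux.  Contrapositive chain: a witness has
a normal form (S1); (T) pins `Λ₀ = 2` and flattens `H`; the head law holds (S2); some scaling limit is a
rotating wave (S4), which is again a witness (S3); `α = 0` is excluded by S5, `α ≠ 0` by S6. -/
theorem composition (h1 : NormalFormExists) (h2 : MovingAdjointBernoulli) (h3 : ScalingClosure)
    (h4 : RotatingWaveReduction) (h5 : SelfSimilarLeaf) (h6 : RotatedLeaf) : Crux := by
  rintro ⟨ν, C, Λ₀, v, q, K, hν, hcl, hTI, hK₁, hK₂, hK₃, hK₄, hK₅, hcomp, hfreq⟩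
  have hW : IsWitness ν C Λ₀ v q K := isWitness_of_body hν hcl hTI hK₁ hK₂ hK₃ hK₄ hK₅ hcomp hfreq
  obtain ⟨C', M, N, w, π, K', hNF⟩ := h1 ν C Λ₀ v q K hW
  obtain ⟨hΛ, hflat⟩ := pinning_of_normalForm hNF
  subst hΛ
  have hHL : HeadLaw ν w π K' :=
    h2 ν M N w π K' hNF.1.1 hNF.1.2.1 hNF.1.2.2.2.1 hNF.1.2.2.2.2.1 hNF.2.1
  obtain ⟨μ, α, U₀, v', q', G, hlim, hrot⟩ := h4 ν C' M _ N w π K' hNF hflat hHL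
  have hW' : IsWitness ν C' 2 v' q' G := h3 ν C' M _ N μ w π K' v' q' G hNF hflat hlim
  by_cases hα : α = 0
  · subst hα
    exact h5 ν C' 2 U₀ v' q' G hW' hrot
  · exact h6 ν C' 2 α U₀ v' q' G hW' hα hrot

/-- THE SKELETON: the crux `AdaptedFrequency.FrequencyRigidity` by name, as a closed term over the six
registered stubs (sorries only inside `stub_*`). -/
theorem FrequencyRigidity_of :
    Summit.NavierStokesRegularity.NavierStokesRegularity.Theses.AdaptedFrequency.FrequencyRigidity :=
  composition stub_normalForm stub_movingAdjointBernoulli stub_scalingClosure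
    stub_rotatingWaveReduction stub_selfSimilarLeaf stub_rotatedLeaf

end Summit.NavierStokesRegularity.NavierStokesRegularity.Cruxes.FrequencyRigidity.MovingAdjointBernoulli

end
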